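import Summits.AtomisticToContinuum.Crystallization.Theorems.SquareWellLayerCakeGapTwelveToBarlowFiveFoldFarDisjointPlanar

/-!
# Far disjoint five-fold rings are antipodal — part 2/3: the unit-vector theorem

Crux `SquareWellLayerCake.GapTwelveToBarlow` (stmt-AtomisticToContinuum-15807), line `Sketch`,
stub `stub_fiveFoldFarDisjoint`.  Everything here is about UNIT vectors of `ℝ³` with the three
cosine thresholds of part 1 (`0.5345` separated, `0.4629` bonded, `0.142` far):

* `ring_frame` — the planar frame of a "ring" (unit vectors at cosine `∈ [0.4629, 0.5345]` from
  an axis, pairwise separated): unit complex directions with pairwise `Re ≤ 0.46`, `Re ≥ 0.23`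
  for bonded pairs, and the law-of-cosines read-out against one more direction;
* `inner_lt_of_ring` (S2) — a unit vector far from the axis `u` of a two-regular ring,
  separated from the ring and far from all but at most one ring site, has `⟪t, u⟫ < -0.33`
  (numerically the supremum is `≈ -0.41`);
* `exists_inner_ge_of_ring` (S1) — if `⟪u, d⟫ > -0.95` some site of a two-regular ring about
  `d` has `⟪t, u⟫ ≥ -0.33`;
* `inner_le_of_two_rings` — hence two such rings force `⟪u, d⟫ ≤ -0.95`.

Mathlib + part 1 only; no named fact is used.
-/

noncomputable section

namespace Summit.AtomisticToContinuum.Crystallization.Theorems.SquareWellLayerCakeGapTwelveToBarlow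

open scoped InnerProductSpace ComplexConjugate Real

/-! ## The frame of a ring -/

/-- **Ring frame.**  Let `e` be a unit axis, `p i` (`i ∈ S`) unit vectors with
`⟪p i, e⟫ ∈ [0.4629, 0.5345]` and pairwise `⟪p i, p j⟫ ≤ 0.5345`, and `q` a unit vector with
`⟪q, e⟫² < 1`.  Reading horizontal parts in `e^⊥ ≃ ℂ` and rotating `q` to `1` gives unit complex
numbers `w i`, horizontal radii `ρ i ≥ 0.845` (`ρ i² = 1 - ⟪p i, e⟫²`) and `ρq > 0` with
`Re (w i) ρ i ρq = ⟪p i, q⟫ - ⟪p i, e⟫ ⟪q, e⟫`,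
`Re (w i conj (w j)) ρ i ρ j = ⟪p i, p j⟫ - ⟪p i, e⟫ ⟪p j, e⟫`, whence pairwise `Re ≤ 0.46`
and `Re ≥ 0.23` for bonded pairs (`⟪p i, p j⟫ ≥ 0.4629`). [folklore] -/
theorem ring_frame {ι : Type*} (S : Finset ι) (e q : EuclideanSpace ℝ (Fin 3))
    (p : ι → EuclideanSpace ℝ (Fin 3)) (he : ‖e‖ = 1) (hq : ‖q‖ = 1) (hqe : ⟪q, e⟫_ℝ ^ 2 < 1)
    (hp : ∀ i ∈ S, ‖p i‖ = 1)
    (hz : ∀ i ∈ S, 0.4629 ≤ ⟪p i, e⟫_ℝ ∧ ⟪p i, e⟫_ℝ ≤ 0.5345)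
    (hpp : ∀ i ∈ S, ∀ j ∈ S, i ≠ j → ⟪p i, p j⟫_ℝ ≤ 0.5345) :
    ∃ (w : ι → ℂ) (ρ : ι → ℝ) (ρq : ℝ),
      (∀ i ∈ S, ‖w i‖ = 1) ∧ (∀ i ∈ S, 0.845 ≤ ρ i ∧ ρ i ^ 2 = 1 - ⟪p i, e⟫_ℝ ^ 2) ∧
      0 < ρq ∧ ρq ^ 2 = 1 - ⟪q, e⟫_ℝ ^ 2 ∧
      (∀ i ∈ S, (w i).re * (ρ i * ρq) = ⟪p i, q⟫_ℝ - ⟪p i, e⟫_ℝ * ⟪q, e⟫_ℝ) ∧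
      (∀ i ∈ S, ∀ j ∈ S, (w i * conj (w j)).re * (ρ i * ρ j) =
        ⟪p i, p j⟫_ℝ - ⟪p i, e⟫_ℝ * ⟪p j, e⟫_ℝ) ∧
      (∀ i ∈ S, ∀ j ∈ S, i ≠ j → (w i * conj (w j)).re ≤ 0.46) ∧
      (∀ i ∈ S, ∀ j ∈ S, 0.4629 ≤ ⟪p i, p j⟫_ℝ → 0.23 ≤ (w i * conj (w j)).re) := by
  obtain ⟨φ, hφ⟩ := exists_planar_frame e he
  have hn2 := norm_sq_of_frame hφ
  have hρ2 : ∀ i ∈ S, ‖φ (p i)‖ ^ 2 = 1 - ⟪p i, e⟫_ℝ ^ 2 := fun i hi => by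
    rw [hn2, hp i hi, one_pow]
  have hρlo : ∀ i ∈ S, 0.845 ≤ ‖φ (p i)‖ := fun i hi => by
    obtain ⟨h1, h2⟩ := hz i hi
    have h := hρ2 i hi
    nlinarith [norm_nonneg (φ (p i))]
  have hρpos : ∀ i ∈ S, 0 < ‖φ (p i)‖ := fun i hi => by linarith [hρlo i hi]
  have hρq2 : ‖φ q‖ ^ 2 = 1 - ⟪q, e⟫_ℝ ^ 2 := by rw [hn2, hq, one_pow]
  have hρqpos : 0 < ‖φ q‖ := by
    have h2 : (0 : ℝ) < ‖φ q‖ ^ 2 := by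
      rw [hρq2]
      linarith
    rcases (norm_nonneg (φ q)).lt_or_eq with h | h
    · exact h
    · rw [← h] at h2
      norm_num at h2
  have hζ1 : ‖φ q / (‖φ q‖ : ℂ)‖ = 1 := norm_div_coe_norm_eq_one hρqpos.ne'
  have hζζ : φ q / (‖φ q‖ : ℂ) * conj (φ q / (‖φ q‖ : ℂ)) = 1 := by
    rw [Complex.mul_conj, Complex.normSq_eq_norm_sq, hζ1]
    norm_num
  refine ⟨fun i => φ (p i) / (‖φ (p i)‖ : ℂ) * conj (φ q / (‖φ q‖ : ℂ)), fun i => ‖φ (p i)‖,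
    ‖φ q‖, ?_, fun i hi => ⟨hρlo i hi, hρ2 i hi⟩, hρqpos, hρq2, ?_, ?_, ?_, ?_⟩
  · intro i hi
    rw [norm_mul, Complex.norm_conj, hζ1, mul_one]
    exact norm_div_coe_norm_eq_one (hρpos i hi).ne'
  · intro i hi
    have h := re_div_mul_conj_div (φ (p i)) (φ q) (hρpos i hi).ne' hρqpos.ne'
    rwa [hφ] at h
  · intro i hi j hj
    have hrot : (φ (p i) / (‖φ (p i)‖ : ℂ) * conj (φ q / (‖φ q‖ : ℂ)) *
        conj (φ (p j) / (‖φ (p j)‖ : ℂ) * conj (φ q / (‖φ q‖ : ℂ)))).re =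
        (φ (p i) / (‖φ (p i)‖ : ℂ) * conj (φ (p j) / (‖φ (p j)‖ : ℂ))).re :=
      re_rot_mul_conj_rot hζζ
    rw [hrot]
    have h := re_div_mul_conj_div (φ (p i)) (φ (p j)) (hρpos i hi).ne' (hρpos j hj).ne'
    rwa [hφ] at h
  · intro i hi j hj hij
    obtain ⟨hzi, -⟩ := hz i hi
    obtain ⟨hzj, -⟩ := hz j hj
    have hprod : 0 < ‖φ (p i)‖ * ‖φ (p j)‖ := mul_pos (hρpos i hi) (hρpos j hj)
    have hzz : 0.4629 * 0.4629 ≤ ⟪p i, e⟫_ℝ * ⟪p j, e⟫_ℝ :=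
      mul_le_mul hzi hzj (by norm_num) (by linarith)
    have hρρ : 0.845 * 0.845 ≤ ‖φ (p i)‖ * ‖φ (p j)‖ :=
      mul_le_mul (hρlo i hi) (hρlo j hj) (by norm_num) (by linarith [hρlo i hi])
    have hrot : (φ (p i) / (‖φ (p i)‖ : ℂ) * conj (φ q / (‖φ q‖ : ℂ)) *
        conj (φ (p j) / (‖φ (p j)‖ : ℂ) * conj (φ q / (‖φ q‖ : ℂ)))).re =
        (φ (p i) / (‖φ (p i)‖ : ℂ) * conj (φ (p j) / (‖φ (p j)‖ : ℂ))).re :=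
      re_rot_mul_conj_rot hζζ
    have h := re_div_mul_conj_div (φ (p i)) (φ (p j)) (hρpos i hi).ne' (hρpos j hj).ne'
    rw [hφ] at h
    refine le_of_mul_le_mul_right ?_ hprod
    rw [hrot, h]
    linarith [hpp i hi j hj hij]
  · intro i hi j hj hb
    obtain ⟨hzi, hzi2⟩ := hz i hi
    obtain ⟨hzj, hzj2⟩ := hz j hj
    have hprod : 0 < ‖φ (p i)‖ * ‖φ (p j)‖ := mul_pos (hρpos i hi) (hρpos j hj)
    have hrot : (φ (p i) / (‖φ (p i)‖ : ℂ) * conj (φ q / (‖φ q‖ : ℂ)) *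
        conj (φ (p j) / (‖φ (p j)‖ : ℂ) * conj (φ q / (‖φ q‖ : ℂ)))).re =
        (φ (p i) / (‖φ (p i)‖ : ℂ) * conj (φ (p j) / (‖φ (p j)‖ : ℂ))).re :=
      re_rot_mul_conj_rot hζζ
    have h := re_div_mul_conj_div (φ (p i)) (φ (p j)) (hρpos i hi).ne' (hρpos j hj).ne'
    rw [hφ] at h
    refine le_of_mul_le_mul_right ?_ hprod
    rw [hrot, h]
    have hi2 := hρ2 i hi
    have hj2 := hρ2 j hj
    nlinarith [sq_nonneg (‖φ (p i)‖ - ‖φ (p j)‖), sq_nonneg (⟪p i, e⟫_ℝ - ⟪p j, e⟫_ℝ),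
      mul_le_mul hzi2 hzj2 (by linarith) (by norm_num)]

/-! ## S2: no admissible direction is high -/

/-- **S2 (no high site).**  Let `u` be a unit axis with a two-regular ring `r i` (`i ∈ S`
nonempty; unit, `⟪r i, u⟫ ∈ [0.4629, 0.5345]`, pairwise `≤ 0.5345`, each with two distinct
bonded partners `≥ 0.4629`).  A unit vector `t` far from the axis (`⟪t, u⟫ ≤ 0.142`), separated
from the ring (`⟪r i, t⟫ ≤ 0.5345`) and far (`≤ 0.142`) from all ring sites but at most one, has
`⟪t, u⟫ < -0.33`.  Proof: if `⟪t, u⟫ ≥ -0.33`, the covering lemma gives a ring site `c` within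
`40°` of azimuth of `t`; `t` far from `c` is absurd (cosine `≥ 0.766·0.797 - 0.177 > 0.142`), so
`t` is far from both partners of `c`, the partner-side lemma puts `c` within `arccos 0.967` of
azimuth, and then `⟪r c, t⟫ ≥ 0.967·0.797 - 0.177 > 0.5345` contradicts separation. [folklore] -/
theorem inner_lt_of_ring {ι : Type*} (S : Finset ι) (hS : S.Nonempty)
    (u t : EuclideanSpace ℝ (Fin 3)) (r : ι → EuclideanSpace ℝ (Fin 3)) (hu : ‖u‖ = 1)
    (ht : ‖t‖ = 1) (hr : ∀ i ∈ S, ‖r i‖ = 1)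
    (hz : ∀ i ∈ S, 0.4629 ≤ ⟪r i, u⟫_ℝ ∧ ⟪r i, u⟫_ℝ ≤ 0.5345)
    (hrr : ∀ i ∈ S, ∀ j ∈ S, i ≠ j → ⟪r i, r j⟫_ℝ ≤ 0.5345)
    (hpart : ∀ i ∈ S, ∃ a ∈ S, ∃ b ∈ S, a ≠ i ∧ b ≠ i ∧ a ≠ b ∧
      0.4629 ≤ ⟪r i, r a⟫_ℝ ∧ 0.4629 ≤ ⟪r i, r b⟫_ℝ)
    (htu : ⟪t, u⟫_ℝ ≤ 0.142) (htr : ∀ i ∈ S, ⟪r i, t⟫_ℝ ≤ 0.5345)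
    (hone : ∀ i ∈ S, ∀ j ∈ S, i ≠ j → ⟪r i, t⟫_ℝ ≤ 0.142 ∨ ⟪r j, t⟫_ℝ ≤ 0.142) :
    ⟪t, u⟫_ℝ < -0.33 := by
  by_contra! hs
  have hqe : ⟪t, u⟫_ℝ ^ 2 < 1 := by nlinarith
  obtain ⟨w, ρ, ρt, hw1, hρ, hρtpos, hρt2, hwq, -, hsep, hbond⟩ :=
    ring_frame S u t r hu ht hqe hr hz hrr
  have hρtlo : 0.943 ≤ ρt := by nlinarith
  have hpart' : ∀ i ∈ S, ∃ a ∈ S, ∃ b ∈ S, a ≠ i ∧ b ≠ i ∧ a ≠ b ∧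
      0.23 ≤ (w i * conj (w a)).re ∧ 0.23 ≤ (w i * conj (w b)).re := by
    intro i hi
    obtain ⟨a, ha, b, hb, hai, hbi, hab, h1, h2⟩ := hpart i hi
    exact ⟨a, ha, b, hb, hai, hbi, hab, hbond i hi a ha h1, hbond i hi b hb h2⟩
  obtain ⟨c, hc, hmc⟩ := exists_re_ge_of_two_partners S hS w (β := 0.23) (γ := 0.46)
    (m := 0.766) (by norm_num) (by norm_num) (by norm_num) (by norm_num) (by norm_num)
    (by norm_num) (by norm_num) (by norm_num) hw1 hsep hpart'
  -- read-out for a ring site: `Re (w i) ρ i ρt = ⟪r i, t⟫ - ⟪r i, u⟫ ⟪t, u⟫`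
  have hread : ∀ i ∈ S, 0.845 * 0.943 ≤ ρ i * ρt ∧
      -(0.5345 * 0.33) ≤ ⟪r i, u⟫_ℝ * ⟪t, u⟫_ℝ := by
    intro i hi
    obtain ⟨hρilo, -⟩ := hρ i hi
    obtain ⟨hzi1, hzi2⟩ := hz i hi
    exact ⟨mul_le_mul hρilo hρtlo (by norm_num) (by linarith), by nlinarith⟩
  obtain ⟨hρρc, hzsc⟩ := hread c hc
  have hwc := hwq c hc
  rcases le_or_gt ⟪r c, t⟫_ℝ 0.142 with hfar | hnear
  · -- `t` far from the nearest ring site: impossible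
    have h : 0.766 * (ρ c * ρt) ≤ (w c).re * (ρ c * ρt) :=
      mul_le_mul_of_nonneg_right hmc (by linarith)
    nlinarith
  · -- `t` close to `c`, hence far from both partners of `c`
    obtain ⟨a, ha, b, hb, hac, hbc, hab, hba, hbb⟩ := hpart c hc
    have hfar2 : ∀ i ∈ S, i ≠ c → ⟪r i, t⟫_ℝ ≤ 0.142 := by
      intro i hi hic
      rcases hone c hc i hi hic.symm with h | h
      · exact absurd h (not_le.2 hnear)
      · exact h
    have hre : ∀ i ∈ S, i ≠ c → (w i).re ≤ 0.401 := by
      intro i hi hic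
      obtain ⟨hρρi, hzsi⟩ := hread i hi
      have hwi := hwq i hi
      have hfi := hfar2 i hi hic
      by_contra! hgt
      have h : 0.401 * (ρ i * ρt) < (w i).re * (ρ i * ρt) :=
        mul_lt_mul_of_pos_right hgt (by linarith)
      nlinarith
    have h1a : 0.23 ≤ (w a * conj (w c)).re :=
      hbond a ha c hc (by rw [real_inner_comm]; exact hba)
    have h1b : 0.23 ≤ (w b * conj (w c)).re :=
      hbond b hb c hc (by rw [real_inner_comm]; exact hbb)
    have hm := re_ge_of_two_far_partners (hw1 c hc) (hw1 a ha) (hw1 b hb) hmc h1a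
      (hsep a ha c hc hac) h1b (hsep b hb c hc hbc) (hsep a ha b hb hab) (hre a ha hac)
      (hre b hb hbc)
    have h : 0.967 * (ρ c * ρt) ≤ (w c).re * (ρ c * ρt) :=
      mul_le_mul_of_nonneg_right hm (by linarith)
    nlinarith [htr c hc]

/-! ## S1: a tilted second ring has a high site -/

/-- **S1 (a high site).**  Let `d` be a unit axis with a two-regular ring `t i` (`i ∈ S`
nonempty; unit, `⟪t i, d⟫ ∈ [0.4629, 0.5345]`, pairwise `≤ 0.5345`, two bonded partners each)
and `u` a unit vector with `-0.95 < ⟪u, d⟫ ≤ 0.142`.  Then some ring site has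
`⟪t i, u⟫ ≥ -0.33`: the horizontal part of `u` has length `≥ 0.312`, the covering lemma gives a
site within `40°` of its azimuth, and `⟪t i, u⟫ ≥ -0.95·0.5345 + 0.766·0.845·0.312 > -0.33`.
[folklore] -/
theorem exists_inner_ge_of_ring {ι : Type*} (S : Finset ι) (hS : S.Nonempty)
    (d u : EuclideanSpace ℝ (Fin 3)) (t : ι → EuclideanSpace ℝ (Fin 3)) (hd : ‖d‖ = 1)
    (hu : ‖u‖ = 1) (ht : ∀ i ∈ S, ‖t i‖ = 1)
    (hz : ∀ i ∈ S, 0.4629 ≤ ⟪t i, d⟫_ℝ ∧ ⟪t i, d⟫_ℝ ≤ 0.5345)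
    (htt : ∀ i ∈ S, ∀ j ∈ S, i ≠ j → ⟪t i, t j⟫_ℝ ≤ 0.5345)
    (hpart : ∀ i ∈ S, ∃ a ∈ S, ∃ b ∈ S, a ≠ i ∧ b ≠ i ∧ a ≠ b ∧
      0.4629 ≤ ⟪t i, t a⟫_ℝ ∧ 0.4629 ≤ ⟪t i, t b⟫_ℝ)
    (ha1 : -0.95 < ⟪u, d⟫_ℝ) (ha2 : ⟪u, d⟫_ℝ ≤ 0.142) :
    ∃ i ∈ S, -0.33 ≤ ⟪t i, u⟫_ℝ := by
  have hqe : ⟪u, d⟫_ℝ ^ 2 < 1 := by nlinarith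
  obtain ⟨w, ρ, b, hw1, hρ, hbpos, hb2, hwq, -, hsep, hbond⟩ :=
    ring_frame S d u t hd hu hqe ht hz htt
  have hblo : 0.312 ≤ b := by nlinarith
  have hpart' : ∀ i ∈ S, ∃ a ∈ S, ∃ b ∈ S, a ≠ i ∧ b ≠ i ∧ a ≠ b ∧
      0.23 ≤ (w i * conj (w a)).re ∧ 0.23 ≤ (w i * conj (w b)).re := by
    intro i hi
    obtain ⟨a, ha, b, hb, hai, hbi, hab, h1, h2⟩ := hpart i hi
    exact ⟨a, ha, b, hb, hai, hbi, hab, hbond i hi a ha h1, hbond i hi b hb h2⟩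
  obtain ⟨c, hc, hmc⟩ := exists_re_ge_of_two_partners S hS w (β := 0.23) (γ := 0.46)
    (m := 0.766) (by norm_num) (by norm_num) (by norm_num) (by norm_num) (by norm_num)
    (by norm_num) (by norm_num) (by norm_num) hw1 hsep hpart'
  refine ⟨c, hc, ?_⟩
  obtain ⟨hρclo, -⟩ := hρ c hc
  obtain ⟨hzc1, hzc2⟩ := hz c hc
  have hwc := hwq c hc
  have hρb : 0.845 * 0.312 ≤ ρ c * b := mul_le_mul hρclo hblo (by norm_num) (by linarith)
  have hza : -(0.95 * 0.5345) ≤ ⟪t c, d⟫_ℝ * ⟪u, d⟫_ℝ := by nlinarith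
  have h : 0.766 * (ρ c * b) ≤ (w c).re * (ρ c * b) :=
    mul_le_mul_of_nonneg_right hmc (by linarith)
  nlinarith

/-! ## Two rings -/

/-- **Two two-regular rings force antipodality.**  Unit axes `u, d` with `⟪u, d⟫ ≤ 0.142`, a
two-regular ring `S` about `u` and one `S'` about `d` (unit sites `n i`, cosine to the own axis
in `[0.4629, 0.5345]`, pairwise separated `≤ 0.5345` within and across the rings, two bonded
partners `≥ 0.4629` each), every site of `S'` far from `u` (`≤ 0.142`) and far from all sites of
`S` but at most one: then `⟪u, d⟫ ≤ -0.95` (S1 against S2). [folklore] -/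
theorem inner_le_of_two_rings {ι : Type*} (S S' : Finset ι) (hS : S.Nonempty)
    (hS' : S'.Nonempty) (u d : EuclideanSpace ℝ (Fin 3)) (n : ι → EuclideanSpace ℝ (Fin 3))
    (hu : ‖u‖ = 1) (hd : ‖d‖ = 1) (hnS : ∀ i ∈ S, ‖n i‖ = 1) (hnS' : ∀ i ∈ S', ‖n i‖ = 1)
    (hzS : ∀ i ∈ S, 0.4629 ≤ ⟪n i, u⟫_ℝ ∧ ⟪n i, u⟫_ℝ ≤ 0.5345)
    (hzS' : ∀ i ∈ S', 0.4629 ≤ ⟪n i, d⟫_ℝ ∧ ⟪n i, d⟫_ℝ ≤ 0.5345)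
    (hsepS : ∀ i ∈ S, ∀ j ∈ S, i ≠ j → ⟪n i, n j⟫_ℝ ≤ 0.5345)
    (hsepS' : ∀ i ∈ S', ∀ j ∈ S', i ≠ j → ⟪n i, n j⟫_ℝ ≤ 0.5345)
    (hpartS : ∀ i ∈ S, ∃ a ∈ S, ∃ b ∈ S, a ≠ i ∧ b ≠ i ∧ a ≠ b ∧
      0.4629 ≤ ⟪n i, n a⟫_ℝ ∧ 0.4629 ≤ ⟪n i, n b⟫_ℝ)
    (hpartS' : ∀ i ∈ S', ∃ a ∈ S', ∃ b ∈ S', a ≠ i ∧ b ≠ i ∧ a ≠ b ∧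
      0.4629 ≤ ⟪n i, n a⟫_ℝ ∧ 0.4629 ≤ ⟪n i, n b⟫_ℝ)
    (hfar : ∀ i ∈ S', ⟪n i, u⟫_ℝ ≤ 0.142)
    (hcross : ∀ i ∈ S, ∀ j ∈ S', ⟪n i, n j⟫_ℝ ≤ 0.5345)
    (hone : ∀ j ∈ S', ∀ a ∈ S, ∀ b ∈ S, a ≠ b → ⟪n a, n j⟫_ℝ ≤ 0.142 ∨ ⟪n b, n j⟫_ℝ ≤ 0.142)
    (hud : ⟪u, d⟫_ℝ ≤ 0.142) : ⟪u, d⟫_ℝ ≤ -0.95 := by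
  by_contra! h
  obtain ⟨i, hi, hge⟩ :=
    exists_inner_ge_of_ring S' hS' d u n hd hu hnS' hzS' hsepS' hpartS' h hud
  have hlt := inner_lt_of_ring S hS u (n i) n hu (hnS' i hi) hnS hzS hsepS hpartS (hfar i hi)
    (fun a ha => hcross a ha i hi) (fun a ha b hb hab => hone i hi a ha b hb hab)
  linarith

/-- Registered anchor of this file (worker, stub `fiveFoldFarDisjoint`): `inner_le_of_two_rings`
for index type `Fin N`, all binders explicit. [folklore] -/
theorem fiveFoldFarDisjoint_twoRings :
    ∀ (N : ℕ) (S S' : Finset (Fin N)) (u d : EuclideanSpace ℝ (Fin 3))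
      (n : Fin N → EuclideanSpace ℝ (Fin 3)), S.Nonempty → S'.Nonempty → ‖u‖ = 1 → ‖d‖ = 1 →
      (∀ i ∈ S, ‖n i‖ = 1) → (∀ i ∈ S', ‖n i‖ = 1) →
      (∀ i ∈ S, 0.4629 ≤ inner ℝ (n i) u ∧ inner ℝ (n i) u ≤ 0.5345) →
      (∀ i ∈ S', 0.4629 ≤ inner ℝ (n i) d ∧ inner ℝ (n i) d ≤ 0.5345) →
      (∀ i ∈ S, ∀ j ∈ S, i ≠ j → inner ℝ (n i) (n j) ≤ 0.5345) →
      (∀ i ∈ S', ∀ j ∈ S', i ≠ j → inner ℝ (n i) (n j) ≤ 0.5345) →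
      (∀ i ∈ S, ∃ a ∈ S, ∃ b ∈ S, a ≠ i ∧ b ≠ i ∧ a ≠ b ∧
        0.4629 ≤ inner ℝ (n i) (n a) ∧ 0.4629 ≤ inner ℝ (n i) (n b)) →
      (∀ i ∈ S', ∃ a ∈ S', ∃ b ∈ S', a ≠ i ∧ b ≠ i ∧ a ≠ b ∧
        0.4629 ≤ inner ℝ (n i) (n a) ∧ 0.4629 ≤ inner ℝ (n i) (n b)) →
      (∀ i ∈ S', inner ℝ (n i) u ≤ 0.142) → (∀ i ∈ S, ∀ j ∈ S', inner ℝ (n i) (n j) ≤ 0.5345) →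
      (∀ j ∈ S', ∀ a ∈ S, ∀ b ∈ S, a ≠ b →
        inner ℝ (n a) (n j) ≤ 0.142 ∨ inner ℝ (n b) (n j) ≤ 0.142) →
      inner ℝ u d ≤ 0.142 → inner ℝ u d ≤ -0.95 :=
  fun _ S S' u d n hS hS' => inner_le_of_two_rings S S' hS hS' u d n

end Summit.AtomisticToContinuum.Crystallization.Theorems.SquareWellLayerCakeGapTwelveToBarlow

end
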